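import Summits.CriticalPhenomena.PercolationContinuityZ3.Theorems.Transplant.FKConnectivityAllQAntipodalRootForm3BasePar
import Summits.CriticalPhenomena.PercolationContinuityZ3.Theorems.Transplant.FKConnectivityAllQAntipodalRootFormRealBox
import Summits.CriticalPhenomena.PercolationContinuityZ3.Theorems.Transplant.FKConnectivityAllQAntipodalRootFormParBox

/-!
# Connectivity correlation inequalities for `φ_{w,q}`, every `q > 0` — ROOT-FORM CALCULUS, file 74c: the REAL two-special environment
# satisfies the `E₁`-side hypotheses of the parallel 2+1 gluing theorem (local-type consistency into the 304; the pivot facts)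

Support file (`--supports stmt-CriticalPhenomena-4575`), FK sub-lane `prim-bschramm-fk-2` (gen 32); builds on p205010 (kernel theorem,
internal audit signed; external expert review pending).  No definitions, no named facts, no sorries; standard axioms.  Memo
FROM-fk-2-g31-DUALITY.md §6 (G4) / §9 (iv), FROM-fk-2-g32-*.md; FK-Q2 §41.

`FK.RootForm.Base3.gcombPar_gMt_nonneg` (file 73d; GLUE(2,1)∥, fact 1 of `E₁ ∥ B`) asks of the abstract two-special environment `E₁`:
local-type consistency `Cert3.consistentP (ptype (E₁ β))`, facts F1/F2sum/F4, the pivot facts Ucony / Uconz (A1 of `E₁` read as a `y`-box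
resp. a `z`-box, the other special being an ordinary free coordinate) and Uexy (exact-level root-U of the `y`-box, nested by both specials).
For the REAL environment `realEnv M C a b y z` (file 61k) of a two-terminal series–parallel edge set `E ∋ y, z` between `a, b`:
* `realEnv_consistentP` — the four edges of the pattern square `∅ → y, ∅ → z, y → yz, z → yz` are the single-flip constraints
  `FK.RootForm.realBox_consistent` (file 61m) of the `y`-box with cell `M ∪ z` and of the `z`-box with cell `M ∪ y`
  (`Cert3.stepOK_of_consistentB`);
* `realEnv_pivotY`, `realEnv_pivotZ` — `FK.RootForm.realBox_A1` for those two boxes against the weight glued along the free coordinate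
  (`nestedExt_mono/apply₀/apply₁` of file 61m);
* `realEnv_exactY` — `FK.RootForm.realBox_A4n` for the `y`-box with cell `M ∪ z` against two glued weights.
F1/F2/F4 are `FK.RootForm.isTTSP_realEnv_facts` (file 61z); F2 in the summed form is `Mt_parE_summed_nonneg`.
[cite: Grimmett2006, §1.4 eq. (1.20) (p. 15); §3.8 Thm. (3.90) (pp. 61–62)] [cite: Wagner2006, Thm. 5.8(d), §5.3]
-/

noncomputable section

namespace Summit.CriticalPhenomena.PercolationContinuityZ3.Theorems

namespace FK

namespace RootForm

open SimpleGraph Finset Literature.Probability.LatticeModels Literature.Probability.Percolation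
open scoped Classical

/-! ## One edge of the pattern square = one single-flip constraint -/

/-- A pattern-cube edge `P → Q` is locally consistent if the single-flip type `⟨K¹_P, K¹_Q, K²_P, K²_Q, Λ_Q − Λ_P⟩` is one of the 21 consistent
box types. [folklore] -/
theorem Cert3.stepOK_of_consistentB (τ : Cert3.PT) (P Q : Fin 4)
    (h : Cert.consistentB ⟨τ.K1 P, τ.K1 Q, τ.K2 P, τ.K2 Q, τ.dL Q - τ.dL P⟩ = true) : Cert3.stepOK τ P Q = true := by
  generalize hc0 : τ.K1 P = c0 at h
  generalize hc1 : τ.K1 Q = c1 at h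
  generalize hd0 : τ.K2 P = d0 at h
  generalize hd1 : τ.K2 Q = d1 at h
  generalize hδ : τ.dL Q - τ.dL P = δ at h
  simp only [Cert3.stepOK, hc0, hc1, hd0, hd1, hδ]
  revert h
  cases c0 <;> cases c1 <;> cases d0 <;> cases d1 <;>
    simp only [Cert.consistentB, Bool.not_true, Bool.not_false, Bool.true_or, Bool.or_true, Bool.false_or, Bool.or_false, Bool.true_and,
      Bool.and_true, Bool.false_and, Bool.and_false, Bool.and_eq_true, decide_eq_true_eq, if_true, if_false, Bool.false_eq_true,
      Bool.and_self, imp_self, and_imp] <;> intros <;> omega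

/-- `r₁ − r₂` in closed form. [folklore] -/
theorem PDat.r1_sub_r2 (d : PDat) (J : ℤ) : d.r1 J - d.r2 J = ind (d.lam = J) * (bit d.k1 - bit d.k2) := by
  obtain ⟨l, k1, k2⟩ := d
  cases k1 <;> cases k2 <;> simp [PDat.r1, PDat.r2, ind, bit]

variable {V : Type*} [Fintype V]

section RealEnv

variable {E M C : Finset (Sym2 V)} {a b uy vy uz vz : V}

omit [Fintype V] in
/-- sums over the configurations of `M ∪ e` split by the state of `e`. [folklore] -/
theorem sum_subtype_powerset_insert {e : Sym2 V} (heM : e ∉ M) (F : Finset (Sym2 V) → ℝ) :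
    ∑ β' : ↥(insert e M).powerset, F β'.1 = ∑ β : ↥M.powerset, (F β.1 + F (insert e β.1)) := by
  rw [Finset.sum_coe_sort (insert e M).powerset F, Finset.sum_powerset_insert heM, ← Finset.sum_add_distrib, ← Finset.sum_coe_sort]

/-- **Every local type of a real two-special environment is one of the 304 consistent types** (`y, z ∉ M`, `y ≠ z`; no other hypothesis).
[cite: Grimmett2006, §1.4 eq. (1.20) (p. 15)] -/
theorem realEnv_consistentP (hyM : s(uy, vy) ∉ M) (hzM : s(uz, vz) ∉ M) (hyz : s(uy, vy) ≠ s(uz, vz)) (β : ↥M.powerset) :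
    Cert3.consistentP (Base3.ptype (realEnv M C a b s(uy, vy) s(uz, vz) β)) = true := by
  obtain ⟨X, hX⟩ := β
  have hXM : X ⊆ M := Finset.mem_powerset.1 hX
  have hyM' : s(uy, vy) ∉ insert s(uz, vz) M := by rw [Finset.mem_insert, not_or]; exact ⟨hyz, hyM⟩
  have hzM' : s(uz, vz) ∉ insert s(uy, vy) M := by rw [Finset.mem_insert, not_or]; exact ⟨hyz.symm, hzM⟩
  -- flips of `y` (cell `M ∪ z`) at `X` and at `X ∪ z`; flips of `z` (cell `M ∪ y`) at `X` and at `X ∪ y`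
  have h01 := realBox_consistent (C := C) (a := a) (b := b) hyM' ⟨X, Finset.mem_powerset.2 (hXM.trans (Finset.subset_insert _ _))⟩
  have h23 := realBox_consistent (C := C) (a := a) (b := b) hyM' ⟨insert s(uz, vz) X, Finset.mem_powerset.2 (Finset.insert_subset_insert _ hXM)⟩
  have h02 := realBox_consistent (C := C) (a := a) (b := b) hzM' ⟨X, Finset.mem_powerset.2 (hXM.trans (Finset.subset_insert _ _))⟩
  have h13 := realBox_consistent (C := C) (a := a) (b := b) hzM' ⟨insert s(uy, vy) X, Finset.mem_powerset.2 (Finset.insert_subset_insert _ hXM)⟩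
  simp only [realBox, realSDat, Base.BDat.type, Finset.insert_comm s(uz, vz) s(uy, vy)] at h01 h23 h02 h13
  simp only [Cert3.consistentP, Bool.and_eq_true]
  refine ⟨⟨⟨Cert3.stepOK_of_consistentB _ 0 1 ?_, Cert3.stepOK_of_consistentB _ 0 2 ?_⟩, Cert3.stepOK_of_consistentB _ 1 3 ?_⟩,
    Cert3.stepOK_of_consistentB _ 2 3 ?_⟩
  · simpa only [Base3.ptype, Cert3.PT.K1, Cert3.PT.K2, Cert3.PT.dL, realEnv, realPDat, sub_zero] using h01
  · simpa only [Base3.ptype, Cert3.PT.K1, Cert3.PT.K2, Cert3.PT.dL, realEnv, realPDat, sub_zero] using h02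
  · simpa only [Base3.ptype, Cert3.PT.K1, Cert3.PT.K2, Cert3.PT.dL, realEnv, realPDat, sub_sub_sub_cancel_right] using h13
  · simpa only [Base3.ptype, Cert3.PT.K1, Cert3.PT.K2, Cert3.PT.dL, realEnv, realPDat, sub_sub_sub_cancel_right] using h23

/-- **Pivot fact at `y` (Ucony)**: A1 of the `y`-box with cell `M ∪ z`, the state of `z` glued into the weight.
[cite: Grimmett2006, §3.8 Thm. (3.90) (pp. 61–62)] -/
theorem realEnv_pivotY (hE : IsTTSP E a b) (hy : s(uy, vy) ∈ E) (hz : s(uz, vz) ∈ E) (hyz : s(uy, vy) ≠ s(uz, vz))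
    (hM : M ⊆ (E.erase s(uy, vy)).erase s(uz, vz)) (hC : C ⊆ (E.erase s(uy, vy)).erase s(uz, vz))
    {h0 h1 : ↥M.powerset → ℝ} (m0 : Monotone h0) (m1 : Monotone h1) (le : ∀ β, h0 β ≤ h1 β) (K : ℤ) :
    0 ≤ ∑ β, (h0 β * ((realEnv M C a b s(uy, vy) s(uz, vz) β).d0.acon K - (realEnv M C a b s(uy, vy) s(uz, vz) β).dy.acon K) +
      h1 β * ((realEnv M C a b s(uy, vy) s(uz, vz) β).dz.acon K - (realEnv M C a b s(uy, vy) s(uz, vz) β).dyz.acon K)) := by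
  have hzM : s(uz, vz) ∉ M := fun h => (Finset.mem_erase.1 (hM h)).1 rfl
  have hM' : insert s(uz, vz) M ⊆ E.erase s(uy, vy) :=
    Finset.insert_subset (Finset.mem_erase.2 ⟨hyz.symm, hz⟩) (hM.trans (Finset.erase_subset _ _))
  have hC' : C ⊆ E.erase s(uy, vy) := hC.trans (Finset.erase_subset _ _)
  have key := realBox_A1 (M := insert s(uz, vz) M) (C := C) hE hy hM' hC'
    (h := fun β' => if s(uz, vz) ∈ β'.1 then h1 ⟨β'.1.erase s(uz, vz) ∩ M, Finset.mem_powerset.2 Finset.inter_subset_right⟩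
      else h0 ⟨β'.1 ∩ M, Finset.mem_powerset.2 Finset.inter_subset_right⟩)
    (fun β₁ β₂ hle => nestedExt_mono s(uz, vz) m0 m1 le hle (Finset.mem_powerset.1 β₂.2)) K
  have key2 := le_of_le_of_eq key (sum_subtype_powerset_insert hzM (fun A : Finset (Sym2 V) =>
    (if s(uz, vz) ∈ A then h1 ⟨A.erase s(uz, vz) ∩ M, Finset.mem_powerset.2 Finset.inter_subset_right⟩
      else h0 ⟨A ∩ M, Finset.mem_powerset.2 Finset.inter_subset_right⟩) *
      Base.gA1 ⟨realSDat (insert s(uz, vz) M) C a b s(uy, vy) A, realSDat (insert s(uz, vz) M) C a b s(uy, vy) (insert s(uy, vy) A)⟩ K))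
  refine key2.trans_eq (Finset.sum_congr rfl fun β _ => ?_)
  rw [nestedExt_apply₀ hzM, nestedExt_apply₁ hzM, Base.gA1_eq, Base.gA1_eq]
  simp only [realSDat, realEnv, realPDat, PDat.acon]
  rfl

/-- **Pivot fact at `z` (Uconz)**: A1 of the `z`-box with cell `M ∪ y`, the state of `y` glued into the weight.
[cite: Grimmett2006, §3.8 Thm. (3.90) (pp. 61–62)] -/
theorem realEnv_pivotZ (hE : IsTTSP E a b) (hy : s(uy, vy) ∈ E) (hz : s(uz, vz) ∈ E) (hyz : s(uy, vy) ≠ s(uz, vz))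
    (hM : M ⊆ (E.erase s(uy, vy)).erase s(uz, vz)) (hC : C ⊆ (E.erase s(uy, vy)).erase s(uz, vz))
    {h0 h1 : ↥M.powerset → ℝ} (m0 : Monotone h0) (m1 : Monotone h1) (le : ∀ β, h0 β ≤ h1 β) (K : ℤ) :
    0 ≤ ∑ β, (h0 β * ((realEnv M C a b s(uy, vy) s(uz, vz) β).d0.acon K - (realEnv M C a b s(uy, vy) s(uz, vz) β).dz.acon K) +
      h1 β * ((realEnv M C a b s(uy, vy) s(uz, vz) β).dy.acon K - (realEnv M C a b s(uy, vy) s(uz, vz) β).dyz.acon K)) := by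
  have hyM : s(uy, vy) ∉ M := fun h => (Finset.mem_erase.1 (Finset.mem_of_mem_erase (hM h))).1 rfl
  have hM' : insert s(uy, vy) M ⊆ E.erase s(uz, vz) :=
    Finset.insert_subset (Finset.mem_erase.2 ⟨hyz, hy⟩) fun e he => Finset.mem_erase.2
      ⟨(Finset.mem_erase.1 (hM he)).1, Finset.mem_of_mem_erase (Finset.mem_of_mem_erase (hM he))⟩
  have hC' : C ⊆ E.erase s(uz, vz) := fun e he => Finset.mem_erase.2
    ⟨(Finset.mem_erase.1 (hC he)).1, Finset.mem_of_mem_erase (Finset.mem_of_mem_erase (hC he))⟩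
  have key := realBox_A1 (M := insert s(uy, vy) M) (C := C) hE hz hM' hC'
    (h := fun β' => if s(uy, vy) ∈ β'.1 then h1 ⟨β'.1.erase s(uy, vy) ∩ M, Finset.mem_powerset.2 Finset.inter_subset_right⟩
      else h0 ⟨β'.1 ∩ M, Finset.mem_powerset.2 Finset.inter_subset_right⟩)
    (fun β₁ β₂ hle => nestedExt_mono s(uy, vy) m0 m1 le hle (Finset.mem_powerset.1 β₂.2)) K
  have key2 := le_of_le_of_eq key (sum_subtype_powerset_insert hyM (fun A : Finset (Sym2 V) =>
    (if s(uy, vy) ∈ A then h1 ⟨A.erase s(uy, vy) ∩ M, Finset.mem_powerset.2 Finset.inter_subset_right⟩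
      else h0 ⟨A ∩ M, Finset.mem_powerset.2 Finset.inter_subset_right⟩) *
      Base.gA1 ⟨realSDat (insert s(uy, vy) M) C a b s(uz, vz) A, realSDat (insert s(uy, vy) M) C a b s(uz, vz) (insert s(uz, vz) A)⟩ K))
  refine key2.trans_eq (Finset.sum_congr rfl fun β _ => ?_)
  rw [nestedExt_apply₀ hyM, nestedExt_apply₁ hyM, Base.gA1_eq, Base.gA1_eq]
  simp only [realSDat, realEnv, realPDat, PDat.acon, Finset.insert_comm s(uz, vz) s(uy, vy)]
  rfl

/-- **Exact-level root-U of the `y`-box, nested by both specials (Uexy)**: A4n of the `y`-box with cell `M ∪ z` against two weights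
glued along `z`. [cite: Grimmett2006, §3.8 Thm. (3.90) (pp. 61–62)] -/
theorem realEnv_exactY (hE : IsTTSP E a b) (hy : s(uy, vy) ∈ E) (hz : s(uz, vz) ∈ E) (hyz : s(uy, vy) ≠ s(uz, vz))
    (hM : M ⊆ (E.erase s(uy, vy)).erase s(uz, vz)) (hC : C ⊆ (E.erase s(uy, vy)).erase s(uz, vz))
    {l0 h0 l1 h1 : ↥M.powerset → ℝ} (ml0 : Monotone l0) (mh0 : Monotone h0) (ml1 : Monotone l1) (mh1 : Monotone h1)
    (le0 : ∀ β, l0 β ≤ h0 β) (le1 : ∀ β, l1 β ≤ h1 β) (lel : ∀ β, l0 β ≤ l1 β) (leh : ∀ β, h0 β ≤ h1 β) (K : ℤ) :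
    0 ≤ ∑ β, (h0 β * ((realEnv M C a b s(uy, vy) s(uz, vz) β).dy.r1 K - (realEnv M C a b s(uy, vy) s(uz, vz) β).dy.r2 K) +
      l0 β * ((realEnv M C a b s(uy, vy) s(uz, vz) β).d0.r1 K - (realEnv M C a b s(uy, vy) s(uz, vz) β).d0.r2 K) +
      h1 β * ((realEnv M C a b s(uy, vy) s(uz, vz) β).dyz.r1 K - (realEnv M C a b s(uy, vy) s(uz, vz) β).dyz.r2 K) +
      l1 β * ((realEnv M C a b s(uy, vy) s(uz, vz) β).dz.r1 K - (realEnv M C a b s(uy, vy) s(uz, vz) β).dz.r2 K)) := by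
  have hzM : s(uz, vz) ∉ M := fun h => (Finset.mem_erase.1 (hM h)).1 rfl
  have hM' : insert s(uz, vz) M ⊆ E.erase s(uy, vy) :=
    Finset.insert_subset (Finset.mem_erase.2 ⟨hyz.symm, hz⟩) (hM.trans (Finset.erase_subset _ _))
  have hC' : C ⊆ E.erase s(uy, vy) := hC.trans (Finset.erase_subset _ _)
  have key := realBox_A4n (M := insert s(uz, vz) M) (C := C) hE hy hM' hC'
    (h0 := fun β' => if s(uz, vz) ∈ β'.1 then l1 ⟨β'.1.erase s(uz, vz) ∩ M, Finset.mem_powerset.2 Finset.inter_subset_right⟩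
      else l0 ⟨β'.1 ∩ M, Finset.mem_powerset.2 Finset.inter_subset_right⟩)
    (h1 := fun β' => if s(uz, vz) ∈ β'.1 then h1 ⟨β'.1.erase s(uz, vz) ∩ M, Finset.mem_powerset.2 Finset.inter_subset_right⟩
      else h0 ⟨β'.1 ∩ M, Finset.mem_powerset.2 Finset.inter_subset_right⟩)
    (fun β₁ β₂ hle => nestedExt_mono s(uz, vz) ml0 ml1 lel hle (Finset.mem_powerset.1 β₂.2))
    (fun β₁ β₂ hle => nestedExt_mono s(uz, vz) mh0 mh1 leh hle (Finset.mem_powerset.1 β₂.2))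
    (fun β' => by split_ifs; exacts [le1 _, le0 _]) K
  have key2 := le_of_le_of_eq key (sum_subtype_powerset_insert hzM (fun A : Finset (Sym2 V) =>
    ((if s(uz, vz) ∈ A then h1 ⟨A.erase s(uz, vz) ∩ M, Finset.mem_powerset.2 Finset.inter_subset_right⟩
      else h0 ⟨A ∩ M, Finset.mem_powerset.2 Finset.inter_subset_right⟩) *
      Base.gA4u ⟨realSDat (insert s(uz, vz) M) C a b s(uy, vy) A, realSDat (insert s(uz, vz) M) C a b s(uy, vy) (insert s(uy, vy) A)⟩ K +
    (if s(uz, vz) ∈ A then l1 ⟨A.erase s(uz, vz) ∩ M, Finset.mem_powerset.2 Finset.inter_subset_right⟩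
      else l0 ⟨A ∩ M, Finset.mem_powerset.2 Finset.inter_subset_right⟩) *
      Base.gA4l ⟨realSDat (insert s(uz, vz) M) C a b s(uy, vy) A, realSDat (insert s(uz, vz) M) C a b s(uy, vy) (insert s(uy, vy) A)⟩ K)))
  refine key2.trans_eq (Finset.sum_congr rfl fun β _ => ?_)
  rw [nestedExt_apply₀ hzM, nestedExt_apply₁ hzM, nestedExt_apply₀ hzM, nestedExt_apply₁ hzM, Base.gA4u_eq, Base.gA4l_eq,
    Base.gA4u_eq, Base.gA4l_eq, PDat.r1_sub_r2, PDat.r1_sub_r2, PDat.r1_sub_r2, PDat.r1_sub_r2]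
  simp only [realSDat, realEnv, realPDat]
  rw [← add_assoc]
  rfl

/-- **F2 in the summed form**: fact 2 against weights that do not read the fresh parallel edge. [folklore] -/
theorem Mt_parE_summed_nonneg {Cfg : Type*} [Fintype Cfg] [Preorder Cfg] {E₁ : Env Cfg}
    (hF2 : ∀ h0 h1 : Bool × Cfg → ℝ, Monotone h0 → Monotone h1 → (∀ p, 0 ≤ h0 p) → (∀ p, h0 p ≤ h1 p) → ∀ K : ℤ,
      0 ≤ Mt (parE E₁) h0 h1 K)
    (h0 h1 : Cfg → ℝ) (m0 : Monotone h0) (m1 : Monotone h1) (n0 : ∀ β, 0 ≤ h0 β) (le : ∀ β, h0 β ≤ h1 β) (K : ℤ) :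
    0 ≤ Mt (parE E₁) (fun p => h0 p.2) (fun p => h1 p.2) K :=
  hF2 _ _ (fun _ _ hpq => m0 (Prod.mk_le_mk.1 hpq).2) (fun _ _ hpq => m1 (Prod.mk_le_mk.1 hpq).2) (fun _ => n0 _) (fun _ => le _) K

end RealEnv

end RootForm

end FK

end Summit.CriticalPhenomena.PercolationContinuityZ3.Theorems

end
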